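import Literature.AlgebraicGeometry.Motives.CrystallineRealization
import HarnessLib

/-!
# Crystalline realization: status of the named fact `BerthelotOgusLineBundleLifting`

`Literature.AlgebraicGeometry.Motives.CrystallineRealization` records Berthelot–Ogus' lifting
criterion for line bundles (Berthelot–Ogus 1983, Thm. 3.8, p. 179: for `X` a smooth proper formal
`V`-scheme whose `H²(X, 𝒪_X)` has `p`-torsion killed by `pᵗ`, and `l` the integer of loc. cit.,
`L₀^{p^{l+t}}` lifts to `X` iff `c₁^cris(L₀)` corresponds under `σ_cris` to an element of
`F¹H²_dR(X/V) ⊗ K`; with `V = W(k)`, `e = 1`, `p > 2`, `t = 0` one has `l = 0`, i.e. `L₀` itself)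
as the `Prop`-valued definition `CrystallineRealization.BerthelotOgusLineBundleLifting C`, RELATIVE
TO a hypothesis structure `C : CrystallineRealization p k` (the "named-fact pattern" of that file's
module docstring: deep theorems about the classical crystalline theory, which Mathlib cannot
construct, are predicates on `C` consumed as hypotheses `(h : C.BerthelotOgusLineBundleLifting)`,
exactly like `WeilCohomology.HasHardLefschetz W`).

## No discharge `∀ C, C.BerthelotOgusLineBundleLifting` exists

The constant has type `CrystallineRealization p k → Prop`; a discharge would be the closed statement
`∀ C, C.BerthelotOgusLineBundleLifting`, and this file checks that such a statement is **not** a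
consequence of the axioms of `CrystallineRealization` (short of their inconsistency):

* `exists_twist_forall_hodgeCondition`: for every `C` there is a `C'` with the SAME underlying
  Weil cohomology theory (same lattices, Frobenius, de Rham realization and comparison maps; only
  the two Chern characters are replaced by `0`, which every axiom mentioning them permits — the
  structure has no normalisation axiom such as `ch₀ = rank`, see "What is deliberately NOT here"
  in the parent file) for which the Hodge condition `C'.HodgeCondition 𝒳 E₁` holds for EVERY
  module `E₁` on every special fibre;
* `berthelotOgusLineBundleLifting_iff_of_forall_hodgeCondition`: for any such `C'` the statement
  `C'.BerthelotOgusLineBundleLifting` is equivalent to "every line bundle on the special fibre of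
  every smooth proper model `𝒳/W` (`p ≠ 2`, `H²(𝒳, 𝒪)` without `p`-torsion) lifts formally";
* `forall_berthelotOgusLineBundleLifting_imp`: hence a uniform discharge would prove that purely
  geometric statement from the mere existence of one crystalline realization. It is false:
  Berthelot–Ogus 1983, Rem. 3.12.1 (p. 181) — for `E` a supersingular elliptic curve and
  `X₀ = E × E` there is `L₀ ∈ NS(X₀)` such that "there is no lifting `X` of `X₀` to `W` to which
  any power of `L₀` extends" (take for `𝒳` a product of lifts of `E`, an abelian scheme over `W`,
  so `H²(𝒳, 𝒪_𝒳) ≅ Λ² H¹(𝒳, 𝒪_𝒳)` is free).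

So the def is correctly a hypothesis predicate and stays undischarged by design; what the axioms do
give formally is the elementary direction for ALGEBRAIC lifts, `bo_chCris_mem_fil_of_liftsTo`
(from `hodgeCondition_of_liftsTo` of the parent file). The direction "formal lift ⇒ condition"
would in addition need Grothendieck's existence theorem (formal line bundles on the completion of a
proper `𝒳/W` algebraize), and "condition ⇒ formal lift" is the content of Thm. 3.8; neither is a
statement about an abstract `C`.

This file declares theorems only (the twisted structure is built inside the proofs).

## References

* P. Berthelot, A. Ogus, *F-isocrystals and de Rham cohomology. I*, Invent. Math. 72 (1983),
  159–199: Thm. 3.8 (p. 179), Prop. 3.12 and Rem. 3.12.1 (pp. 180–181). [BerthelotOgus1983]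
-/

universe u

open CategoryTheory AlgebraicGeometry Opposite

noncomputable section

namespace Literature.AlgebraicGeometry.Motives.CrystallineRealization

open WittScheme

variable {p : ℕ} [Fact p.Prime] {k : Type u} [Field k] [CharP k p] [PerfectRing k p]

/-! ### What the axioms give: algebraic lifts satisfy the Berthelot–Ogus condition -/

/-- The elementary direction of Berthelot–Ogus 1983, Thm. 3.8, for ALGEBRAIC lifts and an
arbitrary crystalline realization `C`: if the module `L` on the special fibre of a smooth proper
model `𝒳/W` is the restriction of a vector bundle on `𝒳` (`LiftsTo`), then `bo (ch₁^cris L)` lies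
in `F¹ H²_dR(X_K/K)` (the case `r = 1` of `hodgeCondition_of_liftsTo`: `bo (ch^cris (E|_{X_k})) =
ch^dR (E|_{X_K})`, an algebraic class, hence in the Hodge filtration).
[cite: BerthelotOgus1983, Thm. 3.8] -/
theorem bo_chCris_mem_fil_of_liftsTo (C : CrystallineRealization p k) {n : ℕ}
    {𝒳 : SchemeOver (WittVector p k)} (h𝒳 : IsSmoothProperModel n 𝒳)
    {L : (specialFibre 𝒳).left.Modules} (hL : LiftsTo 𝒳 L) :
    C.bo 𝒳 (2 * 1) (C.chCris (specialFibre 𝒳) L 1) ∈ C.dR.fil (2 * 1) 1 :=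
  C.hodgeCondition_of_liftsTo h𝒳 hL 1

/-! ### The universal closure is not formal: the zero-Chern-character twist -/

/-- **The zero-Chern-character twist.** For every crystalline realization `C` there is a
crystalline realization `C'` with the same underlying Weil cohomology theory (in the proof: the
same lattices, Frobenius, de Rham realization and Berthelot–Ogus maps as well, with `chCris := 0`
and `chDR := 0`; all axioms on the Chern characters — invariance, functoriality, additivity,
algebraicity, compatibility under `bo` — hold for `0`) in which the Hodge condition
`C'.HodgeCondition 𝒳 E₁` (`bo (chᵣ^cris E₁) ∈ Fʳ` for all `r`) holds for every module `E₁` on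
every special fibre, because it reads `0 ∈ Fʳ`. Records that the axioms of
`CrystallineRealization` do not tie `HodgeCondition` to geometry. [folklore] -/
theorem exists_twist_forall_hodgeCondition (C : CrystallineRealization p k) :
    ∃ C' : CrystallineRealization p k, C'.toWeilCohomology = C.toWeilCohomology ∧
      ∀ (𝒳 : SchemeOver (WittVector p k)) (E₁ : (specialFibre 𝒳).left.Modules),
        C'.HodgeCondition 𝒳 E₁ := by
  refine ⟨{ C with
    chCris := fun _ _ _ => 0
    chDR := fun _ _ _ => 0
    chCris_congr := fun _ _ _ _ _ => rfl
    chDR_congr := fun _ _ _ _ _ => rfl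
    pullback_chCris := fun _ _ _ _ _ _ => by simp
    pullback_chDR := fun _ _ _ _ _ _ => by simp
    chCris_shortExact := fun _ _ _ _ _ _ => by simp
    chDR_shortExact := fun _ _ _ _ _ _ => by simp
    chCris_mem_ratAlgebraicClasses := fun _ _ _ _ _ => zero_mem _
    chDR_mem_ratAlgebraicClasses := fun _ _ _ _ _ => zero_mem _
    bo_chCris := fun _ _ _ _ _ _ => by simp }, rfl, fun 𝒳 E₁ r => ?_⟩
  change C.bo 𝒳 (2 * r) 0 ∈ C.dR.fil (2 * r) r
  rw [map_zero]
  exact zero_mem _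

/-- If the Hodge condition of `C'` holds for every module on every special fibre (as for the twist
of `exists_twist_forall_hodgeCondition`), then `C'.BerthelotOgusLineBundleLifting` is equivalent
to the purely geometric statement "for `p ≠ 2`, every line bundle on the special fibre of every
smooth proper model `𝒳/W` with `H²(𝒳, 𝒪_𝒳)` free of `p`-torsion lifts formally" — which is
false (Berthelot–Ogus 1983, Rem. 3.12.1: on `X₀ = E × E`, `E` supersingular, some `L₀ ∈ NS(X₀)`
has no power extending to any lifting of `X₀` over `W`). [cite: BerthelotOgus1983, Rem. 3.12.1] -/
theorem berthelotOgusLineBundleLifting_iff_of_forall_hodgeCondition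
    (C' : CrystallineRealization p k)
    (hC' : ∀ (𝒳 : SchemeOver (WittVector p k)) (E₁ : (specialFibre 𝒳).left.Modules),
      C'.HodgeCondition 𝒳 E₁) :
    C'.BerthelotOgusLineBundleLifting ↔
      ∀ ⦃n : ℕ⦄ ⦃𝒳 : SchemeOver (WittVector p k)⦄, IsSmoothProperModel n 𝒳 → p ≠ 2 →
        (∀ x : structureSheafCohomology 𝒳.left 2, (p : ℤ) • x = 0 → x = 0) →
        ∀ L : (specialFibre 𝒳).left.Modules, HasRank L 1 → LiftsFormally 𝒳 L :=
  ⟨fun h _ 𝒳 h𝒳 hp hH L hL => (h h𝒳 hp hH L hL).mpr (hC' 𝒳 L 1),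
    fun h _ 𝒳 h𝒳 hp hH L hL => ⟨fun _ => hC' 𝒳 L 1, fun _ => h h𝒳 hp hH L hL⟩⟩

/-- **No uniform discharge.** A proof of `∀ C, C.BerthelotOgusLineBundleLifting` would yield, from
the existence of a single crystalline realization `C₀` over `k`, that for `p ≠ 2` every line bundle
on the special fibre of every smooth proper model `𝒳/W(k)` with `H²(𝒳, 𝒪_𝒳)` free of `p`-torsion
lifts formally (apply it to the zero-Chern-character twist of `C₀`). By Berthelot–Ogus 1983,
Rem. 3.12.1 this conclusion fails classically, so `BerthelotOgusLineBundleLifting` is — as its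
docstring says — a hypothesis on `C`, not a dischargeable fact.
[cite: BerthelotOgus1983, Rem. 3.12.1] -/
theorem forall_berthelotOgusLineBundleLifting_imp (C₀ : CrystallineRealization p k)
    (h : ∀ C : CrystallineRealization p k, C.BerthelotOgusLineBundleLifting) ⦃n : ℕ⦄
    ⦃𝒳 : SchemeOver (WittVector p k)⦄ (h𝒳 : IsSmoothProperModel n 𝒳) (hp : p ≠ 2)
    (hH : ∀ x : structureSheafCohomology 𝒳.left 2, (p : ℤ) • x = 0 → x = 0)
    (L : (specialFibre 𝒳).left.Modules) (hL : HasRank L 1) : LiftsFormally 𝒳 L := by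
  obtain ⟨C', -, hC'⟩ := exists_twist_forall_hodgeCondition C₀
  exact (berthelotOgusLineBundleLifting_iff_of_forall_hodgeCondition C' hC').mp (h C') h𝒳 hp hH L hL

end Literature.AlgebraicGeometry.Motives.CrystallineRealization

end
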